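import Summits.ABC.IUTFork.ForkLocalGlobalWitness
import Summits.ABC.IUTFork.Cor312TeamAGapWitness
import Summits.ABC.IUTFork.Cor312LogKummerRoute
import HarnessLib

/-!
# [IUTchIII] Cor. 3.12 — the volume-transport inputs of the log-Kummer route are NOT NECESSARY (quantifier certificate)

Record-only file (D-0012) of the abc-iut cell (wave-5 prover seat abc-iut-w5-d087; ADJUDICATION support piece for
HUMAN RULING D-0067, `HOME/plan/ADJUDICATION-SPEC.md` §2 (G1′) «QUANTIFIER LEVEL of the gap statement» and §4 (ii)
«STRONGER-THAN-PRINT»); TAKES NO SIDE; proof-only plus witness definitions; fact-free.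

CONTEXT. Team B's log-Kummer route (abc-iut-c312-11, `Cor312LogKummerRoute`) proves the printed Statement of
[IUTchIII] Cor. 3.12 (kurims May 2020 `paper:url-4b091feeb646`, p. 173 l. 41 – p. 174 l. 19; typed verbatim as
`Cor312.Setting.Statement`) from the bridge hypotheses plus ONE input, `Cor312Vol.VolumeTransport` — in EVERY
packet `(j, v_ℚ)` the `q`-pilot log-volume is at most the log-volume of SOME single Kummer image of the Θ-pilot
object (Step (xi-g), p. 184 l. 30–34, relaxed to `≤`); its layer 2 moves that input to the holomorphic side of
Thm. 3.11 (ii) (a) (`FrobVolumeTransport`, `QFrobComparison`, `QFrobEqualityAt`; all PER PACKET). The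
adjudication spec (G1′) records that the print compares two GLOBAL procession-normalised numbers and asks, for a
per-packet gap statement, a CERTIFICATE that it is strictly stronger than the typed Corollary. The skeleton's
`Cor312Vol.LocalGlobal.fork` (`ForkLocalGlobalWitness`) certifies this for R0/R2/R3/R4 and for `VolumeTransport`
stated inline, but its `lgSituation` violates the degree clause of the typed Thm. 3.11 (i) (degrees `0`, volumes
`−1`); Team A's `GapWitness.thm311_bridgeHyps_not_imp_statement` has typed Thm. 3.11 TRUE and Cor. 3.12 FALSE.

THIS FILE closes that square. `QFrobWitness.qfFull` / `qfSetting`: ONE instantiation (the skeleton's two-valued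
log-volume `lgVol` over Team A's degree-`(−1)` Frobenioid objects, a Kummer-EXACT column, Team A's one-point link
data; `l⋇ = 2`, one place; at the label `2` the Θ-pilot Kummer images are `{0}` (volume `−3`) and the `q`-pilot
image is everything (volume `−1`), at the label `1` the roles are swapped) in which SIMULTANEOUSLY

* the typed **Theorem 3.11 (i) ∧ (ii) ∧ (iii) HOLDS** (`qfFull_statement`; (ii) (a) `KummerA`: `qfColumn_kummerA`);
* **every bridge hypothesis** of `Cor312StatementBridge` holds (`qfSetting_bridgeHyps`), "`|log(q)| > 0`"
  (`qf_absLogQPos`), and the Kummer images are admissible (`qf_thetaRegionsAdm`);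
* the typed **Corollary 3.12 HOLDS** (`qf_statement`: `−|log(Θ)| = −|log(q)| = −2`, by the procession average); and
* the B-inputs **FAIL**: `qf_not_volumeTransport : ¬ VolumeTransport qfSetting` (BY NAME), and the layer-2 forms
  (declarations not yet in the tree at the time of writing; stated as their literal unfoldings over THIS column)
  `qf_not_frobComparison`, `qf_not_frobEqualityAt` (any single `m`), `qf_not_frobVolumeTransport`.

`volumeTransport_not_necessary` packages the ∃-statement. READING FOR THE BLOCK (neutral): with Team A's witness
(premises ∧ ¬ Statement, where the B-input also fails since it implies the Statement, `statement_of_volumeTransport`)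
the B-input is INDEPENDENT of {typed Thm. 3.11, bridge hypotheses, `|log(q)| > 0`} and STRICTLY STRONGER than the
typed Cor. 3.12 — an INTERFACE-LEVEL fact about quantifier shape (per packet vs. global), the (G1′) grading; it says
nothing about the assembled real setting nor about whether Thm. 3.11 licenses the printed inference.
[claim: Mochizuki2012, status: disputed] for the quoted definitions; the theorems are [folklore] arithmetic on the
witness. Deliberately NOT here: any judgement on Step (xi); the real setting.
-/

noncomputable section

namespace Summit.ABC

namespace IUTFork

namespace Cor312Vol

namespace QFrobWitness

open Thm311 Cor312 Cor312.Checks Literature.IUT.LogThetaLattice LocalGlobal GapWitness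

/-! ## 1. The situation: skeleton volumes, Team A degrees, a Kummer-exact column, Team A link data -/

/-- The witness situation: c312-7's toy log-shells (`ℚ`-lines, `l⋇ = 2`, one place), the skeleton's two-valued
data `lgData` (log-volume `−3` on subsets of `{0}`, `−1` elsewhere, everything admissible) on every vertical
line, and Team A's Frobenioid objects of degree `−1` with region everything (so the degree clause of
Thm. 3.11 (i) (c) reads `−1 = −1`). [folklore] -/
def qfSituation : Situation toyIndex where
  L := toyShells
  D := fun _ => lgData
  G := fun _ j => gapDegrees j

/-- A Kummer-EXACT column over the toy shells: the holomorphic admissibility/log-volume read through the Kummer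
isomorphisms at every `(n, m)` ARE the coric data of `lgData`; unit/ball images everything; one-point
Frobenioid objects. [folklore] -/
def qfColumn : Column toyShells where
  frobAdm := fun _ _ _ _ => True
  frobLogvol := fun _ j vQ A => lgVol j vQ A
  frobΨ := fun _ _ _ => ∅
  frobMmod := fun _ _ => ∅
  unitImage := fun _ _ _ _ => Set.univ
  ballImage := fun _ _ _ => Set.univ
  ObjLGP := Unit
  frobObjLGP := fun _ => Unit
  kumLGP := fun _ => Equiv.refl Unit
  ObjLgp := Unit
  frobObjLgp := fun _ => Unit
  kumLgp := fun _ => Equiv.refl Unit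
  thetaPilot := fun _ => ()

/-- The full witness situation: the Kummer-exact column on every vertical line and Team A's one-point link
data `GapWitness.gapLink` (every poly-isomorphism full, every induced automorphism the identity). [folklore] -/
def qfFull : FullSituation toyIndex where
  toSituation := qfSituation
  col := fun _ => qfColumn
  link := gapLink

/-- (ii) (a) holds for the witness column against the witness data: the readings coincide. [folklore] -/
theorem qfColumn_kummerA : qfColumn.KummerA lgData := fun _ _ _ _ _ => ⟨trivial, rfl⟩

/-! ## 2. The typed Theorem 3.11 holds in the witness -/

/-- (i) holds: the splitting monoids are empty, the degree clause reads `−1 = −1`, the classes `^{n,∘}R^{LGP}`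
coincide (the same data on every line). [folklore] -/
theorem qf_partI : qfFull.PartI := by
  refine ⟨fun n v hv x hx => absurd hx (Set.notMem_empty x), fun n j J => ⟨fun _ => trivial, ?_, ?_⟩,
    fun n n' => rfl⟩
  · exact Set.toFinite _
  · show (-1 : ℝ) = ∑ᶠ vQ : toyIndex.VQ, lgVol j.1 vQ Set.univ
    simp only [lgVol_univ]
    rw [finsum_unique]

/-- (ii) holds, column by column: the transported data are literally the coric data, the unit images lie in
the (total) integral structures, there are no archimedean places. [folklore] -/
theorem qf_partII : qfFull.toLatticeSituation.PartII := by
  intro n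
  refine (Column.partII_iff _ _).2 ⟨qfColumn_kummerA, fun _ _ _ => rfl, fun _ _ => rfl, ?_⟩
  exact ⟨fun m m' j vQ _ => Set.subset_univ _, fun m j vQ h => absurd trivial h⟩

/-- (iii) holds: the link data ARE Team A's `gapLink`, for which (a)–(d) are landed
(`GapWitness.gap_partIII`); the «up to (Ind1), (Ind2), (Ind3)» clause follows from (i). [folklore] -/
theorem qf_partIII : qfFull.PartIII :=
  ⟨gap_partIII.1, gap_partIII.2.1, gap_partIII.2.2.1, gap_partIII.2.2.2.1,
    qfFull.evalCompatUpToInd_of_multiradialCompat qf_partI.2.2⟩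

/-- **The typed Theorem 3.11 (i) ∧ (ii) ∧ (iii) HOLDS in the witness.** [folklore] -/
theorem qfFull_statement : Summit.ABC.IUTFork.Thm311.FullSituation.Statement qfFull :=
  ⟨qf_partI, qf_partII, qf_partIII⟩

/-! ## 3. The setting: Θ- and `q`-pilot images swapped between the labels `𝔽_l^⋇ = {1, 2}` -/

/-- The WITNESS SETTING over `qfSituation` (the skeleton's `lgSetting`, verbatim, over the degree-`(−1)`
situation): column `n = 0`; at label `2` every Kummer image of the Θ-pilot object is `{0}` (volume `−3`) and the
`q`-pilot image is everything (volume `−1`); at the other labels the roles are swapped; the skeleton's NONEMPTY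
hull frame `lgFrame`; one-point lattice / Prop. 3.7 / pilot data. [folklore] -/
def qfSetting : Setting qfSituation where
  n := 0
  HT := ℤ × ℤ
  LogLink := fun _ _ => Unit
  IsFull := fun _ => True
  lattice :=
    { theater := fun n m => (n, m)
      distinct := fun p q h => by simpa using h
      logLink := fun _ _ => ()
      logLink_full := fun _ _ => trivial }
  Frd := Unit
  IsoF := fun _ _ => Unit
  Ob := fun _ => Unit
  realify := id
  Strip := Unit
  IsoS := fun _ _ => Unit
  M := fun _ _ => Unit
  sig := toySig
  split := { Msplit := fun _ _ => ⊤, exists_gen := fun _ _ => ⟨⟨(), trivial⟩, top_unit_isGenerator _⟩ }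
  ObΔ := Unit
  N := fun _ _ => Unit
  qData := { q := fun _ _ => (), q_gen := fun _ _ => unit_isGenerator _, objOf := fun _ => () }
  frame := fun _ _ => lgFrame _
  hul_adm := fun _ _ _ _ => trivial
  thetaRegionOf := fun _ _ j _ => if j = 2 then {0} else Set.univ
  qRegionOf := fun _ j _ => if j = 2 then Set.univ else {0}
  qRegion_mem := fun j _ => by
    show (if j = 2 then Set.univ else {0} : Set _).Nonempty
    split_ifs
    · exact Set.univ_nonempty
    · exact Set.singleton_nonempty 0
  qSupport_finite := fun _ => Set.toFinite _

/-- Every single Kummer image of the Θ-pilot object: `{0}` at label `2`, everything elsewhere (independent of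
`m`). [folklore] -/
theorem qf_thetaRegion (m : ℤ) (j : toyIndex.Label) (vQ : toyIndex.VQ) :
    qfSetting.thetaRegion m j vQ = if j = 2 then {0} else Set.univ := rfl

/-- The `q`-pilot image: everything at label `2`, `{0}` elsewhere. [folklore] -/
theorem qf_qRegion (j : toyIndex.Label) (vQ : toyIndex.VQ) :
    qfSetting.qRegion j vQ = if j = 2 then Set.univ else {0} := rfl

/-- The (Ind3)-enlarged Θ-region of the witness. [folklore] -/
theorem qf_thetaRegion3 (j : toyIndex.Label) (vQ : toyIndex.VQ) :
    qfSetting.thetaRegion3 j vQ = if j = 2 then {0} else Set.univ := by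
  unfold Setting.thetaRegion3 Setting.thetaRegion
  exact Set.iUnion_const _

/-- It is nonempty. [folklore] -/
theorem qf_thetaRegion3_nonempty (j : toyIndex.Label) (vQ : toyIndex.VQ) :
    (qfSetting.thetaRegion3 j vQ).Nonempty := by
  rw [qf_thetaRegion3]
  split_ifs
  · exact Set.singleton_nonempty 0
  · exact Set.univ_nonempty

/-- Every possible image of the witness IS the (Ind3)-enlarged region (`{0}` and everything are fixed by the
`ℚ`-linear indeterminacies). [folklore] -/
theorem qf_eq_of_mem_possibleImages {j : toyIndex.Label} {vQ : toyIndex.VQ}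
    {U : Set (qfSituation.L.Packet j vQ)} (hU : U ∈ qfSetting.possibleImages j vQ) :
    U = qfSetting.thetaRegion3 j vQ := by
  obtain ⟨Φ, -, rfl⟩ := hU
  rw [qf_thetaRegion3]
  split_ifs
  · rw [Set.image_singleton, map_zero]
  · exact Set.image_univ_of_surjective (Φ j vQ).surjective

/-- Hence the union of the possible images is that region … [folklore] -/
theorem qf_sUnion_possibleImages (j : toyIndex.Label) (vQ : toyIndex.VQ) :
    ⋃₀ qfSetting.possibleImages j vQ = qfSetting.thetaRegion3 j vQ :=
  Set.Subset.antisymm (Set.sUnion_subset fun _ hU => (qf_eq_of_mem_possibleImages hU).le)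
    (Set.subset_sUnion_of_mem (qfSetting.thetaRegion3_mem_possibleImages j vQ))

/-- … and so is its holomorphic hull. [folklore] -/
theorem qf_thetaHull (j : toyIndex.Label) (vQ : toyIndex.VQ) :
    qfSetting.thetaHull j vQ = qfSetting.thetaRegion3 j vQ := by
  unfold Setting.thetaHull
  rw [qf_sUnion_possibleImages]
  exact lgFrame_hull (qf_thetaRegion3_nonempty j vQ)

/-- Every packet union admits its hull. [folklore] -/
theorem qf_hullDefined (j : toyIndex.Label) (vQ : toyIndex.VQ) : qfSetting.HullDefined j vQ :=
  ⟨trivial, by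
    show (⋃₀ qfSetting.possibleImages j vQ).Nonempty
    rw [qf_sUnion_possibleImages]; exact qf_thetaRegion3_nonempty j vQ⟩

/-! ## 4. The two printed quantities: `−|log(Θ)| = −|log(q)| = −2`; the Corollary HOLDS -/

/-- The local Θ-volume of the witness: `−3` at label `2`, `−1` elsewhere. [folklore] -/
theorem qf_thetaLocal (j : toyIndex.Label) (vQ : toyIndex.VQ) :
    qfSetting.thetaLocal j vQ = ((if j = 2 then (-3 : ℝ) else -1 : ℝ) : WithTop ℝ) := by
  unfold Setting.thetaLocal
  rw [if_pos (qf_hullDefined j vQ), qf_thetaHull, qf_thetaRegion3]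
  show ((lgVol j vQ (if j = 2 then {0} else Set.univ) : ℝ) : WithTop ℝ) = _
  split_ifs
  · rw [lgVol_of_subset Set.Subset.rfl]
  · rw [lgVol_univ]

/-- The local `q`-volume of the witness: `−1` at label `2`, `−3` elsewhere. [folklore] -/
theorem qf_qLocal (j : toyIndex.Label) (vQ : toyIndex.VQ) :
    qfSetting.qLocal j vQ = if j = 2 then (-1 : ℝ) else -3 := by
  show lgVol j vQ (if j = 2 then Set.univ else {0}) = _
  split_ifs
  · exact lgVol_univ j vQ
  · exact lgVol_of_subset Set.Subset.rfl

/-- The witness is `ThetaFinite`. [folklore] -/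
theorem qf_thetaFinite : qfSetting.ThetaFinite :=
  ⟨fun i vQ => by rw [qf_thetaLocal]; exact WithTop.coe_ne_top, fun _ => Set.toFinite _⟩

/-- The sum over `Fin l⋇ = Fin 2` of the toy, split at the two labels. [folklore] -/
theorem sum_fin_lstar (f : Fin toyIndex.lstar → ℝ) :
    (∑ i, f i) / (toyIndex.lstar : ℝ) = (f iOne + f iTwo) / 2 := by
  show (∑ i : Fin 2, f i) / ((2 : ℕ) : ℝ) = _
  rw [Fin.sum_univ_two]
  rfl

/-- `−|log(Θ)| = ((−1) + (−3))/2 = −2` in the witness. [folklore] -/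
theorem qf_negLogTheta : qfSetting.negLogTheta = ((-2 : ℝ) : WithTop ℝ) := by
  rw [qfSetting.negLogTheta_eq_of_thetaFinite qf_thetaFinite]
  congr 1
  simp only [qf_thetaLocal, WithTop.untopD_coe, finsum_unique]
  unfold processionNormalized
  rw [sum_fin_lstar, if_neg labelSucc_iOne_ne_two, if_pos labelSucc_iTwo]
  norm_num

/-- `−|log(q)| = ((−3) + (−1))/2 = −2` in the witness. [folklore] -/
theorem qf_negLogQ : qfSetting.negLogQ = -2 := by
  unfold Setting.negLogQ
  simp only [qf_qLocal, finsum_unique]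
  unfold processionNormalized
  rw [sum_fin_lstar, if_neg labelSucc_iOne_ne_two, if_pos labelSucc_iTwo]
  norm_num

/-- **The typed Corollary 3.12 HOLDS in the witness** (`−2 ≤ −2`). [folklore] -/
theorem qf_statement : Summit.ABC.IUTFork.Cor312.Setting.Statement qfSetting :=
  (qfSetting.statement_iff_real qf_negLogTheta).mpr (by rw [qf_negLogQ])

/-- "`|log(q)| > 0`" holds in the witness (`−|log(q)| = −2 < 0`). [folklore] -/
theorem qf_absLogQPos : Summit.ABC.IUTFork.Cor312.Setting.AbsLogQPos qfSetting := by
  show qfSetting.negLogQ < 0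
  rw [qf_negLogQ]; norm_num

/-- **ALL bridge hypotheses of `Cor312StatementBridge` hold in the witness.** [folklore] -/
theorem qfSetting_bridgeHyps : Summit.ABC.IUTFork.Cor312Vol.BridgeHyps qfSetting where
  mono := fun _ _ _ _ _ _ hAB => lgVol_mono hAB
  image_adm := fun _ _ _ _ => trivial
  image_fin := fun _ => Set.toFinite _
  hul_nonempty := fun _ _ _ hH => hH
  theta_nonempty := fun _ vQ => qf_thetaRegion3_nonempty _ vQ
  finite := qf_thetaFinite

/-- The Kummer images of the Θ-pilot object are admissible (everything is). [folklore] -/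
theorem qf_thetaRegionsAdm : Summit.ABC.IUTFork.Cor312Vol.ThetaRegionsAdm qfSetting :=
  fun _ _ _ => trivial

/-- (ii) (a) for the column carrying the setting (`n = 0`) against the data of its line. [folklore] -/
theorem qf_kummerA : (qfFull.col qfSetting.n).KummerA (qfFull.D qfSetting.n) := qfColumn_kummerA

/-! ## 5. The B-inputs FAIL in the witness -/

/-- **`VolumeTransport` FAILS in the witness** (BY NAME): at label `2` every single Kummer image is `{0}`, of
volume `−3 < −1 = qLocal`. [folklore] -/
theorem qf_not_volumeTransport : ¬ Summit.ABC.IUTFork.Cor312Vol.VolumeTransport qfSetting := by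
  intro h
  obtain ⟨m, hm⟩ := h iTwo ()
  rw [qf_qLocal, if_pos labelSucc_iTwo] at hm
  have h3 : (qfSituation.D qfSetting.n).logvol (Setting.labelSucc iTwo) ()
      (qfSetting.thetaRegion m (Setting.labelSucc iTwo) ()) = -3 :=
    lgVol_of_subset (subset_of_eq (by rw [qf_thetaRegion, if_pos labelSucc_iTwo]; rfl))
  rw [h3] at hm
  norm_num at hm

/-- The holomorphic log-volume of the column at the `q`-pilot image, label `2`: `−1`. [folklore] -/
theorem qf_frobLogvol_qRegion (m : ℤ) :
    (qfFull.col qfSetting.n).frobLogvol m (Setting.labelSucc iTwo) () (qfSetting.qRegion (Setting.labelSucc iTwo) ()) =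
      -1 := by
  show lgVol _ () (qfSetting.qRegion (Setting.labelSucc iTwo) ()) = -1
  rw [qf_qRegion, if_pos labelSucc_iTwo]
  exact lgVol_univ _ ()

/-- The holomorphic log-volume of the column at the `m`-th Θ-pilot image, label `2`: `−3`. [folklore] -/
theorem qf_frobLogvol_thetaRegion (m m' : ℤ) :
    (qfFull.col qfSetting.n).frobLogvol m (Setting.labelSucc iTwo) ()
        (qfSetting.thetaRegion m' (Setting.labelSucc iTwo) ()) = -3 := by
  show lgVol _ () (qfSetting.thetaRegion m' (Setting.labelSucc iTwo) ()) = -3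
  exact lgVol_of_subset (subset_of_eq (by rw [qf_thetaRegion, if_pos labelSucc_iTwo]; rfl))

/-- **The holomorphic-side comparison FAILS in the witness**: there is no lattice position `m` at which the
holomorphic log-volume reading (through the column's Kummer isomorphisms) of the `q`-pilot image is at most
that of the `m`-th Kummer image of the Θ-pilot object in every packet — at label `2` it would read `−1 ≤ −3`.
This is the literal unfolding, over THIS lattice situation and setting, of Team B's `QFrobComparison`
(layer 2 of `Cor312LogKummerRoute`). [folklore] -/
theorem qf_not_frobComparison :
    ¬ ∀ (i : Fin toyIndex.lstar) (vQ : toyIndex.VQ), ∃ m : ℤ,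
        (qfFull.col qfSetting.n).frobLogvol m (Setting.labelSucc i) vQ (qfSetting.qRegion (Setting.labelSucc i) vQ) ≤
          (qfFull.col qfSetting.n).frobLogvol m (Setting.labelSucc i) vQ
            (qfSetting.thetaRegion m (Setting.labelSucc i) vQ) := by
  intro h
  obtain ⟨m, hm⟩ := h iTwo ()
  rw [qf_frobLogvol_qRegion, qf_frobLogvol_thetaRegion] at hm
  norm_num at hm

/-- Nor does the uniform EQUALITY form hold at any single position `m` (the unfolding of Team B's
`QFrobEqualityAt m`: "two tautologically equivalent ways to compute the log-volume of the `q`-pilot object",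
p. 184 l. 30–34, as typed per packet). [folklore] -/
theorem qf_not_frobEqualityAt (m : ℤ) :
    ¬ ∀ (i : Fin toyIndex.lstar) (vQ : toyIndex.VQ),
        (qfFull.col qfSetting.n).frobLogvol m (Setting.labelSucc i) vQ (qfSetting.qRegion (Setting.labelSucc i) vQ) =
          (qfFull.col qfSetting.n).frobLogvol m (Setting.labelSucc i) vQ
            (qfSetting.thetaRegion m (Setting.labelSucc i) vQ) := by
  intro h
  have hm := h iTwo ()
  rw [qf_frobLogvol_qRegion, qf_frobLogvol_thetaRegion] at hm
  norm_num at hm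

/-- Nor does the holomorphic-side transport hold (the unfolding of Team B's `FrobVolumeTransport`: `qLocal ≤`
holomorphic log-volume of some Θ-image; at label `2`: `−1 ≤ −3`). [folklore] -/
theorem qf_not_frobVolumeTransport :
    ¬ ∀ (i : Fin toyIndex.lstar) (vQ : toyIndex.VQ), ∃ m : ℤ,
        qfSetting.qLocal (Setting.labelSucc i) vQ ≤
          (qfFull.col qfSetting.n).frobLogvol m (Setting.labelSucc i) vQ
            (qfSetting.thetaRegion m (Setting.labelSucc i) vQ) := by
  intro h
  obtain ⟨m, hm⟩ := h iTwo ()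
  rw [qf_qLocal, if_pos labelSucc_iTwo, qf_frobLogvol_thetaRegion] at hm
  norm_num at hm

/-! ## 6. The certificate, as one statement -/

/-- **THE VOLUME-TRANSPORT INPUT IS NOT NECESSARY FOR THE TYPED COROLLARY 3.12 (quantifier certificate,
interface level).** There is an instantiation in which the typed Theorem 3.11 (i) ∧ (ii) ∧ (iii) holds IN FULL,
every bridge hypothesis of the verbatim statement holds, `|log(q)| > 0`, the Kummer images of the Θ-pilot object
are admissible, the typed Corollary 3.12 HOLDS — and Team B's per-packet input `VolumeTransport` FAILS (as do
its holomorphic-side forms, `qf_not_frobComparison` / `qf_not_frobEqualityAt` / `qf_not_frobVolumeTransport`).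
With Team A's `GapWitness.thm311_bridgeHyps_not_imp_statement` (same premises, Corollary FALSE, hence input
FALSE by `statement_of_volumeTransport`) this makes the B-input independent of the premises and strictly
stronger than the typed Corollary: the (G1′) grading «STRONGER-THAN-PRINT (per packet vs. global)» of
`HOME/plan/ADJUDICATION-SPEC.md`, kernel-checked. Nothing here concerns the assembled real setting.
[folklore] -/
theorem volumeTransport_not_necessary :
    ∃ (T : ThetaIndex) (F : FullSituation T) (P : Setting F.toLatticeSituation.toSituation),
      Summit.ABC.IUTFork.Thm311.FullSituation.Statement F ∧
        Summit.ABC.IUTFork.Cor312Vol.BridgeHyps P ∧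
        Summit.ABC.IUTFork.Cor312.Setting.AbsLogQPos P ∧
        Summit.ABC.IUTFork.Cor312Vol.ThetaRegionsAdm P ∧
        (F.col P.n).KummerA (F.D P.n) ∧
        Summit.ABC.IUTFork.Cor312.Setting.Statement P ∧
        ¬ Summit.ABC.IUTFork.Cor312Vol.VolumeTransport P ∧
        ¬ (∀ (i : Fin T.lstar) (vQ : T.VQ), ∃ m : ℤ,
            (F.col P.n).frobLogvol m (Setting.labelSucc i) vQ (P.qRegion (Setting.labelSucc i) vQ) ≤
              (F.col P.n).frobLogvol m (Setting.labelSucc i) vQ (P.thetaRegion m (Setting.labelSucc i) vQ)) :=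
  ⟨toyIndex, qfFull, qfSetting, qfFull_statement, qfSetting_bridgeHyps, qf_absLogQPos, qf_thetaRegionsAdm,
    qf_kummerA, qf_statement, qf_not_volumeTransport, qf_not_frobComparison⟩

end QFrobWitness

end Cor312Vol

end IUTFork

end Summit.ABC

end
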